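import Mathlib
import HarnessLib
import Summits.CriticalPhenomena.CardyFormulaZ2.Theorems.CardyComplexConeEdgeCoherenceLeeYangLaurent

/-!
# Sub-goal `indexGF_structure` of line `Sketch` (composition `LeeYang`) for crux `CardyComplexCone.EdgeCoherence`

Route `CardyComplexCone` (sub-problem `CriticalPhenomena/CardyFormulaZ2`), crux
`Summit.CriticalPhenomena.CardyFormulaZ2.Theses.CardyComplexCone.EdgeCoherence` (item stmt-CriticalPhenomena-11385).
Helper file `--supports stmt-CriticalPhenomena-11385`: it proves the registered sub-goal `indexGF_structure` of
line `Sketch`, composition `LeeYang` — **STRUCTURE**: for admissible data `E` the winding-index generating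
function `Z(ζ) = indexGF E δ v ζ` of the definitions module
`Theorems/CardyComplexConeEdgeCoherenceLeeYangDefs.lean` is a *Laurent polynomial with non-negative real
coefficients*: there are a finite set `s ⊂ ℤ` of exponents and a profile `p : ℤ → ℝ`, `p ≥ 0`, with
`Z(ζ) = Σ_{m ∈ s} p m · ζ ^ m` (the profile is `p_m(v) = E #{darts of the exploration at v of index m}`).
This is the positivity structure behind the two open bets `stub_equidistribution` / `stub_domination` of the
composition, both statements about the positive profile `p_m(v)`.

## Content and proof

* `indexGF_eq_finsetSum`: by locality of the exploration (`medialExploration_inter_edgeSet`: the path reads `ω`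
  only on the finite edge set `S = E(Ω_δ)`, `edgeSet_finite`) and the finite-sum representation of the integral of
  a local functional (`integral_eq_sum_of_forall_inter`, module `…LeeYangLaurent`),
  `Z(ζ) = Σ_{A ⊆ S} P{ω ∩ S = A} · Σ_c Σ_{k ∈ darts(A, c)} ζ ^ {m(A, k)}` — a finite triple sum, valid for EVERY `ζ`.
* `sum_mul_sum_sum_zpow_eq_sum_sigma`, `sum_mul_zpow_eq_sum_image`: the weighted triple sum is one sum
  `Σ_{i ∈ T} w_i ζ^{e_i}` over a finite sigma index (`Finset.sum_sigma`, `Finset.mul_sum`), which regroups by the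
  value of the exponent (`Finset.sum_fiberwise_of_maps_to`) into `Σ_{m ∈ e(T)} (Σ_{i : e_i = m} w_i) ζ^m`; the
  weights `P{ω ∩ S = A} ≥ 0` (`measureReal_nonneg`) give non-negative coefficients (`indexGF_laurent`, guard-free;
  the registered `indexGF_structure` is its restriction to `ζ ≠ 0`).
* Corollaries every user of the bets wants: at a real fugacity `x ≥ 0` the value `Z(x)` is the non-negative real
  `Σ_m p_m x^m` (`indexGF_ofReal_eq`, `indexGF_ofReal_im`, `indexGF_ofReal_re_nonneg`), and the termwise triangle
  inequality `‖Z(z)‖ ≤ Σ_m p_m ‖z‖^m = Re Z(‖z‖)` (`norm_indexGF_le`).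

Sources: H. Duminil-Copin, S. Smirnov, *Conformal invariance of lattice models*, Clay Math. Proc. 15 (2012)
§6.2 (locality of the exploration), §8 (the spin-`1/3` observable); idea card
`Cruxes/EdgeCoherence/Ideas/lee-yang-winding-fugacity.md`. Everything is elementary and proved inline.
-/

noncomputable section

namespace Summit.CriticalPhenomena.CardyFormulaZ2.Cruxes.EdgeCoherence.LeeYang

open scoped BigOperators Topology
open Filter Set MeasureTheory
open Literature.Probability.LatticeModels Literature.Probability.RandomPlanarGeometry
open Literature.Probability.Percolation (BondConfig bondPercolation half)
open Summit.CriticalPhenomena.CardyFormulaZ2.Cruxes.EdgeCoherence.FixedRadiusCut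
  (medialExploration_inter_edgeSet edgeSet_finite)

/-! ### Regrouping finite sums of weighted integer powers by the exponent -/

/-- **Fiberwise regrouping.** A finite sum of weighted integer powers `Σ_{i ∈ T} w_i ζ^{e_i}` is the Laurent
polynomial `Σ_{m ∈ e(T)} (Σ_{i ∈ T, e_i = m} w_i) ζ^m` (group the index set by the value of the exponent). -/
theorem sum_mul_zpow_eq_sum_image {ι : Type*} (T : Finset ι) (w : ι → ℝ) (e : ι → ℤ) (ζ : ℂ) :
    ∑ i ∈ T, (w i : ℂ) * ζ ^ (e i) =
      ∑ m ∈ T.image e, ((∑ i ∈ T.filter (fun i => e i = m), w i : ℝ) : ℂ) * ζ ^ m := by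
  rw [← Finset.sum_fiberwise_of_maps_to (fun i hi => Finset.mem_image_of_mem e hi)
    (fun i => (w i : ℂ) * ζ ^ (e i))]
  refine Finset.sum_congr rfl fun m _ => ?_
  rw [Complex.ofReal_sum, Finset.sum_mul]
  refine Finset.sum_congr rfl fun i hi => ?_
  rw [(Finset.mem_filter.1 hi).2]

/-- A finite sum of **non-negatively** weighted integer powers is a Laurent polynomial with non-negative
coefficients: exponent set `e(T)`, coefficient of `ζ^m` the sum of the weights of the fibre `{i ∈ T | e_i = m}`. -/
theorem exists_laurent_of_sum_mul_zpow {ι : Type*} (T : Finset ι) {w : ι → ℝ} (hw : ∀ i, 0 ≤ w i)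
    (e : ι → ℤ) :
    ∃ (s : Finset ℤ) (p : ℤ → ℝ), (∀ m, 0 ≤ p m) ∧
      ∀ ζ : ℂ, ∑ i ∈ T, (w i : ℂ) * ζ ^ (e i) = ∑ m ∈ s, (p m : ℂ) * ζ ^ m :=
  ⟨T.image e, fun m => ∑ i ∈ T.filter (fun i => e i = m), w i,
    fun _ => Finset.sum_nonneg fun i _ => hw i, fun ζ => sum_mul_zpow_eq_sum_image T w e ζ⟩

/-- **Flattening the triple sum.** The weighted triple sum `Σ_{A ∈ T} w_A · Σ_{c : Fin 4} Σ_{k ∈ J A c} ζ^{e A k}`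
(the shape of the finite-sum representation of `indexGF`) is one sum of weighted integer powers over the finite
sigma index `{(A, c, k) | A ∈ T, k ∈ J A c}`. -/
theorem sum_mul_sum_sum_zpow_eq_sum_sigma {α κ : Type*} (T : Finset α) (w : α → ℝ)
    (J : α → Fin 4 → Finset κ) (e : α → κ → ℤ) (ζ : ℂ) :
    ∑ A ∈ T, (w A : ℂ) * ∑ c : Fin 4, ∑ k ∈ J A c, ζ ^ (e A k) =
      ∑ x ∈ T.sigma (fun A => (Finset.univ : Finset (Fin 4)).sigma fun c => J A c),
        (w x.1 : ℂ) * ζ ^ (e x.1 x.2.2) := by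
  rw [Finset.sum_sigma]
  refine Finset.sum_congr rfl fun A _ => ?_
  rw [Finset.mul_sum, Finset.sum_sigma]
  refine Finset.sum_congr rfl fun c _ => ?_
  rw [Finset.mul_sum]

/-- **Abstract structure lemma.** A function with a representation
`f ζ = Σ_{A ∈ T} w_A · Σ_{c : Fin 4} Σ_{k ∈ J A c} ζ^{e A k}` with non-negative weights `w_A` is a Laurent
polynomial with non-negative coefficients. -/
theorem exists_laurent_of_eq_sum_mul_sum_sum_zpow {α κ : Type*} {f : ℂ → ℂ} (T : Finset α) {w : α → ℝ}
    (hw : ∀ A, 0 ≤ w A) (J : α → Fin 4 → Finset κ) (e : α → κ → ℤ)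
    (hf : ∀ ζ, f ζ = ∑ A ∈ T, (w A : ℂ) * ∑ c : Fin 4, ∑ k ∈ J A c, ζ ^ (e A k)) :
    ∃ (s : Finset ℤ) (p : ℤ → ℝ), (∀ m, 0 ≤ p m) ∧ ∀ ζ : ℂ, f ζ = ∑ m ∈ s, (p m : ℂ) * ζ ^ m := by
  obtain ⟨s, p, hp, h⟩ := exists_laurent_of_sum_mul_zpow
    (T.sigma fun A => (Finset.univ : Finset (Fin 4)).sigma fun c => J A c)
    (w := fun x => w x.1) (fun x => hw x.1) (fun x => e x.1 x.2.2)
  exact ⟨s, p, hp, fun ζ => ((hf ζ).trans (sum_mul_sum_sum_zpow_eq_sum_sigma T w J e ζ)).trans (h ζ)⟩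

/-! ### Consequences of a non-negative Laurent representation -/

/-- At a real argument `x ≥ 0` a Laurent polynomial with real coefficients takes the real value `Σ_m p_m x^m`. -/
theorem sum_ofReal_mul_zpow_ofReal (s : Finset ℤ) (p : ℤ → ℝ) (x : ℝ) :
    ∑ m ∈ s, (p m : ℂ) * (x : ℂ) ^ m = ((∑ m ∈ s, p m * x ^ m : ℝ) : ℂ) := by
  push_cast
  rfl

/-- **Termwise triangle inequality.** For non-negative coefficients,
`‖Σ_m p_m z^m‖ ≤ Σ_m p_m ‖z‖^m = Re (Σ_m p_m ‖z‖^m)`. -/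
theorem norm_sum_ofReal_mul_zpow_le (s : Finset ℤ) {p : ℤ → ℝ} (hp : ∀ m, 0 ≤ p m) (z : ℂ) :
    ‖∑ m ∈ s, (p m : ℂ) * z ^ m‖ ≤ (∑ m ∈ s, (p m : ℂ) * ((‖z‖ : ℝ) : ℂ) ^ m).re := by
  rw [sum_ofReal_mul_zpow_ofReal, Complex.ofReal_re]
  refine (norm_sum_le _ _).trans (le_of_eq (Finset.sum_congr rfl fun m _ => ?_))
  rw [norm_mul, norm_zpow, Complex.norm_real, Real.norm_of_nonneg (hp m)]

/-! ### The generating function is a finite sum -/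

variable {E : DiscreteDobrushin}

/-- **Finite-sum representation of the generating function.** For admissible data the exploration path reads
`ω` only on the finite edge set `S = E(Ω_δ)` (`medialExploration_inter_edgeSet`, `edgeSet_finite`), so for EVERY
`ζ` the integral `Z(ζ) = indexGF E δ v ζ` is the finite sum over the configurations `A ⊆ S` of
`P{ω ∩ S = A}` times the dart sum of the (deterministic) path `medialExploration E A`
(`integral_eq_sum_of_forall_inter`). -/
theorem indexGF_eq_finsetSum (hE : E.IsZdAdmissible) (δ : ℝ) (v : Site 2) (ζ : ℂ) :
    indexGF E δ v ζ = ∑ A ∈ (edgeSet_finite hE).finite_subsets.toFinset,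
      (bondPercolation (zdGraph 2) half).real
          {ω : BondConfig (Site 2) | ω ∩ (discreteDomainGraph E.Ω E.δ).edgeSet = A} *
        ∑ c : Fin 4, ∑ k ∈ (Finset.range
            (Literature.Probability.LatticeModels.medialExploration E A).length).filter (fun k =>
              (Literature.Probability.LatticeModels.medialExploration E A)[k]? =
                some (Literature.Probability.LatticeModels.cornerSource v (faceAt v c)) ∧
              (Literature.Probability.LatticeModels.medialExploration E A)[k + 1]? =
                some (Literature.Probability.LatticeModels.cornerTarget v (faceAt v c))),
          ζ ^ (round (Literature.Probability.LatticeModels.Polyline.winding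
            (((Literature.Probability.LatticeModels.medialExploration E A).map
              (Literature.Probability.LatticeModels.medialPoint δ)).take (k + 2)) / (Real.pi / 2)) : ℤ) :=
  integral_eq_sum_of_forall_inter (edgeSet_finite hE) _ fun ω => by
    simp only [medialExploration_inter_edgeSet]

/-- **The generating function is a non-negative Laurent polynomial** (guard-free form): for admissible data there
are a finite exponent set `s ⊂ ℤ` and a profile `p ≥ 0` with `Z(ζ) = Σ_{m ∈ s} p m · ζ^m` for every `ζ ∈ ℂ`
(`indexGF_eq_finsetSum` regrouped by the exponent, `exists_laurent_of_eq_sum_mul_sum_sum_zpow`; the weights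
`P{ω ∩ S = A}` are non-negative, `measureReal_nonneg`). -/
theorem indexGF_laurent (hE : E.IsZdAdmissible) (δ : ℝ) (v : Site 2) :
    ∃ (s : Finset ℤ) (p : ℤ → ℝ), (∀ m, 0 ≤ p m) ∧
      ∀ ζ : ℂ, indexGF E δ v ζ = ∑ m ∈ s, (p m : ℂ) * ζ ^ m :=
  exists_laurent_of_eq_sum_mul_sum_sum_zpow _ (fun _ => measureReal_nonneg) _ _
    (indexGF_eq_finsetSum hE δ v)

/-! ### The registered sub-goal -/

/-- **Sub-goal `indexGF_structure`** (registered sub-goal of line `Sketch`, composition `LeeYang`): for admissible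
data the winding-index generating function `Z = indexGF E δ v` is, off the origin, a Laurent polynomial
`Σ_{m ∈ s} p m · ζ^m` with NON-NEGATIVE real coefficients `p m` (the expected number of darts of the exploration
path at `v` of winding index `m`). Immediate from the guard-free `indexGF_laurent`. -/
theorem indexGF_structure : ∀ (E : DiscreteDobrushin) (δ : ℝ) (v : Site 2), E.IsZdAdmissible →
    ∃ (s : Finset ℤ) (p : ℤ → ℝ), (∀ m, 0 ≤ p m) ∧
      ∀ ζ : ℂ, ζ ≠ 0 → indexGF E δ v ζ = ∑ m ∈ s, (p m : ℂ) * ζ ^ m := by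
  intro E δ v hE
  obtain ⟨s, p, hp, h⟩ := indexGF_laurent hE δ v
  exact ⟨s, p, hp, fun ζ _ => h ζ⟩

/-! ### Corollaries: real fugacities and the termwise triangle inequality -/

/-- At a real fugacity `x` the generating function takes the real value `Σ_m p_m x^m` of its profile. -/
theorem indexGF_ofReal_eq (hE : E.IsZdAdmissible) (δ : ℝ) (v : Site 2) :
    ∃ (s : Finset ℤ) (p : ℤ → ℝ), (∀ m, 0 ≤ p m) ∧
      ∀ x : ℝ, indexGF E δ v x = ((∑ m ∈ s, p m * x ^ m : ℝ) : ℂ) := by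
  obtain ⟨s, p, hp, h⟩ := indexGF_laurent hE δ v
  exact ⟨s, p, hp, fun x => (h x).trans (sum_ofReal_mul_zpow_ofReal s p x)⟩

/-- **`Z(x)` is real at real fugacity**: `Im Z(x) = 0` for every real `x`. -/
theorem indexGF_ofReal_im (hE : E.IsZdAdmissible) (δ : ℝ) (v : Site 2) (x : ℝ) :
    (indexGF E δ v x).im = 0 := by
  obtain ⟨s, p, -, h⟩ := indexGF_ofReal_eq hE δ v
  rw [h x, Complex.ofReal_im]

/-- **`Z(x) ≥ 0` at non-negative real fugacity**: `0 ≤ Re Z(x)` for `0 ≤ x` (non-negative profile,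
`zpow_nonneg`). -/
theorem indexGF_ofReal_re_nonneg (hE : E.IsZdAdmissible) (δ : ℝ) (v : Site 2) {x : ℝ} (hx : 0 ≤ x) :
    0 ≤ (indexGF E δ v x).re := by
  obtain ⟨s, p, hp, h⟩ := indexGF_ofReal_eq hE δ v
  rw [h x, Complex.ofReal_re]
  exact Finset.sum_nonneg fun m _ => mul_nonneg (hp m) (zpow_nonneg hx m)

/-- **Termwise triangle inequality (domination by the positive axis)**: `‖Z(z)‖ ≤ Re Z(‖z‖)` for every `z ∈ ℂ`
(`‖p_m z^m‖ = p_m ‖z‖^m` for `p_m ≥ 0`). In particular the rotated values `Z(x i^k)` never exceed `Z(x)` at a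
positive real fugacity `x`. -/
theorem norm_indexGF_le (hE : E.IsZdAdmissible) (δ : ℝ) (v : Site 2) (z : ℂ) :
    ‖indexGF E δ v z‖ ≤ (indexGF E δ v (‖z‖ : ℂ)).re := by
  obtain ⟨s, p, hp, h⟩ := indexGF_laurent hE δ v
  rw [h z, h (‖z‖ : ℂ)]
  exact norm_sum_ofReal_mul_zpow_le s hp z

/-- The rotated values at a non-negative real fugacity are dominated by the unrotated one:
`‖Z(x u)‖ ≤ Re Z(x)` for `0 ≤ x` and `‖u‖ = 1` (e.g. `u = i^k`). -/
theorem norm_indexGF_ofReal_mul_le (hE : E.IsZdAdmissible) (δ : ℝ) (v : Site 2) {x : ℝ} (hx : 0 ≤ x)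
    {u : ℂ} (hu : ‖u‖ = 1) :
    ‖indexGF E δ v ((x : ℂ) * u)‖ ≤ (indexGF E δ v (x : ℂ)).re := by
  have h := norm_indexGF_le hE δ v ((x : ℂ) * u)
  rwa [norm_mul, hu, mul_one, Complex.norm_real, Real.norm_of_nonneg hx] at h

end Summit.CriticalPhenomena.CardyFormulaZ2.Cruxes.EdgeCoherence.LeeYang

end
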